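/-
Copyright: statement-level skeleton of a published paper (lit-balaban cell, Phase-2 proof seat p27 gen 30). No proof claims
beyond what the kernel checks below.
-/
import Literature.MathematicalPhysics.QuantumFieldTheory.Balaban1983to89.B3TadpoleZeroTorusTwoDim

/-!
# B3 — T. Bałaban, *(Higgs)₂,₃ quantum fields in a finite volume. III. Renormalization*, CMP **88** (1983) 411–445
[Balaban1983Higgs3], p. 439 [PDF 29]: the split **(3.22)** of the second graph of (3.21) and the resummed vertex **(3.23)** — the
**`d = 2` INSTANCES** at the zero-field torus model (`A = B̃ = 0`, `Ω = T_η`): the `(Higgs)₂` twins of p18 g8's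
`B3Eq322PositiveDegree.eq322_zero_torus` and p20 g6's `B3Eq323EtaZeroTorus.eq323_zero_torus` (`d = 3`).  In `d = 2` the (3.23) vertex
function is bounded by `C₁·L^kε` by absolute values alone.  File 2 of 2 (file 1: `B3TadpoleZeroTorusTwoDim`, the p. 438 tadpole
sentence and graph (a) of (3.21) in `d = 2`).

statement-level skeleton of published theorems with citation tags; proofs where landed; nothing here is a claim about
the Yang–Mills mass gap

PDF held: `paper:balaban1983-higgs-2-3-quantum-fields-finite-volume` (journal page = PDF page + 410); pp. 438–439 [PDF 28–29] read in
the OCR text (`p0028.txt`, `p0029.txt`); pp. 422–423 [PDF 12–13] ((2.1)–(2.2)) through rows B3.Eq2.1 / B3.Eq2.2-2.3 of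
`HOME/lit-balaban-r15/ROWS-B3.md`.

CITATION HEADER (lean-in-tree rule).  Part of the lit-balaban TYPED SKELETON (HOME `run/shared/lean/pub/lit-balaban/`), PHASE 2,
seat p27 generation 30 (free-target protocol G.5-34(d); item 2 of §5 of the fold owner's `lit-balaban-r15/B3-CLOSURE.md` v1.0:
*"d = 2 instances of (3.22)/(3.23) and of the p. 438 tadpole sentence"*).  WHAT IS REPRODUCED: row **B3.Eq3.21-3.24** of
`HOME/lit-balaban-r15/ROWS-B3.md` (fold owner r15, referee ref-4), sub-displays (3.22)/(3.23), zero-field torus members, `d = 2`.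
CONSUMES BY NAME, nothing re-proved: file 1 `B3TadpoleZeroTorusTwoDim.gpiece_bounds_two` (p20 g5's `gpiece_bounds` read in `d = 2`),
p18 g8's `B3Eq322OneLegDifferentiated` (`expr321b`, `rem322`, `sum_expr321b_eq`) and `B3Eq322PositiveDegree.abs_rem322_le` (the
*"positive degree"* estimate, every `d`), r15's `B3Sect3ScalarSelfEnergy` (`bracket323`, `expr323`, `d1Kernel`), p20 g4's
`B3Resummation315.d1Kernel_finset_sum`/`expr323_sum_sum`, p20 g2's `B3TorusRadialSums.radial_sum_le`, p39 g6's
`B3GkZeroTorusRescaled.scaleSum_le_max`/`scaleConst_nonneg`/`zeroConst_nonneg`/`piece_exp_le`/`spacing_le_one`, p20 g6's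
`B3Eq317ZeroTorus.sum_gpiece_apply`, p20 g2's `B3Taylor310Remainder.HolderDeriv`.

THE PRINTED TEXT (verbatim, p. 439).  *"The second expression is transformed in a way similar to (3.17) and (3.20): (3.22) The first
graph on the right side has positive degree, the second is treated in the same way as the expression (3.15): we sum over proper
orderings and j-indices and we get Σ_{μ=1}^d Σ_x η^dφ(x)·[q²Σ_{x′}η^d(∂^η_μG^η_{j″}(0))(x,x′)g(x)G^η_{j″}(x,x′)g′(x′)](∂^η_μφ′)(x).
(3.23) Further if we take g′(x′) = g′(x) + ((g′(x′) − g′(x))/|x′−x|)|x′−x|, then the expression in the square bracket in (3.23)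
containing the second term will be convergent … Hence the last graph in (3.22) defines a vertex with some convergent function."*
The paper is written for `d = 2, 3` throughout (title; (2.1) p. 422 *"−(d−2)/2"*).

THE `d = 2` POWER COUNTING (why no cancellation is needed).  By (2.1)–(2.2) pp. 422–423 the class (3.21) has degree `3 − d` (p18 g3's
`B3Sect3LowestOrderGraphs.g321a_deg`/`g321b_deg` on the model graphs): `0` in `d = 3` (marginal: the `d = 3` files go through the
(3.16) split `G^ξ_k(0) = C^ξ + M` and the (3.24) identity), `1` in `d = 2`.  In `d = 2` the (2.10) piece bounds are
`|G^η_{(j)}(x,x′)| ≤ Ce^{−δ|x−x′|/L^jη}` and `|(∂^η_μG^η_{(j)})(x,x′)| ≤ C(L^jη)^{−1}e^{−δ|x−x′|/L^jη}`, so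
`|[bracket (3.23)](x)| ≤ Σ_{x′}η²|(∂^η_μG^η_k)(x,x′)||G^η_k(x,x′)| ≤ C²C_s·η·Σ_{i′<k}Σ_{x′}e^{−δ|x−x′|_∞/L^{i′}}/max(1,|x−x′|_∞)
≤ C²C_s·η·(13k + 24L^k/(δ(L−1))) ≤ C₁·L^kη`: the vertex function is bounded (and vanishes with the ultraviolet length `L^kη ≤ 1`); the
p. 439 splitting of `g′` is the `d = 3` device and is not needed here.

WHAT IS PROVED (all at `P.d = 2`, zero-field torus instance, `η = ε`, `G^η_k = Σ_{j<k}G^η_{(j)}` the tower pieces `gpiece`, `1 ≤ k ≤ K`;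
constants are functions of `L, a, m²` only — uniform in the volume `(m, K)` and the scale `k`).
* §3 `inner_radial_le_two` (the `d = 2` radial sum `Σ_{x′}e^{−a|x−x′|_∞}/max(1,|x−x′|_∞) ≤ 13 + 24/a`, p20 g2's `radial_sum_le` with
  `κ = 1`, `p = 0`), **`abs_bracket323_le_two`** (`|[bracket (3.23)](G^η_k(0),G^η_k)(x)| ≤ C₁·L^kε` for `|g|,|g′| ≤ 1`),
  `abs_expr323_le_two`, **`eq323_zero_torus_two`** = p20 g6's `eq323_zero_torus` at `d = 2`: (a) the summation over `j, j′ < j″` of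
  the (3.23)-terms of the pieces IS (3.23) on the resummed propagators, (b) `|(3.23)| ≤ C₁(L^kε)·Σ_μΣ_xη²‖φ(x)‖‖q²(∂^η_μφ′)(x)‖`,
  (c) `≤ C₁·Σ…` (`L^kε ≤ 1`).
* §4 **`eq322_zero_torus_two`** = p18 g8's `eq322_zero_torus` at `d = 2`: (a) `Σ_{j,j′<k}expr321b[G^η_{(j)},G^η_{(j′)}] =
  Σ_{j,j′<k}rem322[j,j′] + (3.23)[G^η_k(0),G^η_k]`, (b) the vertex bound of §3, (c) `abs_rem322_le` for every piece pair with the kernel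
  hypotheses DISCHARGED by `gpiece_bounds` (`d = 2`: factors `(L^jη)^{1−d} = (L^jη)^{−1}`, `(L^{j′}η)^{2−d} = 1`, gain `(L^{j₁}η)^α`).
HONEST SCOPE: the model instance `A = B̃ = 0`, `U ≡ 1`, `Ω` = the whole torus, `d = 2`, fixed `a > 0`, `m² ≥ 0`, odd `L > 1`;
constants existential; in `d = 2` the class (3.21) is power-counting convergent (degree `1`), so these are the `d = 2` members of
displays the paper states for `d = 2, 3` alike — identities and bounds, not a renormalization; the summation *"over proper orderings
and j-indices"* is taken literally over `[0,j″)²` (as in `B3Resummation315`); the volume sums of §4 (c) are not resolved into the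
cube-localized display (3.13) (p20 g5's `B3Ineq314Cubes` applies verbatim); the `ξ → 0` limit (3.24) is p03's `B3Eq324Parseval`
(`eq324_rhs_tendsto_two`, limit `0` in `d = 2`) and is not re-derived.  D-0026: theorems only — no `def`, no named fact, no `sorry`;
standard axioms.  Unit `lit-balaban-p27-g30` (literature-prover-lit-balaban-p27-g30-0), HOME `run/shared/lean/pub/lit-balaban/`,
2026-08-22.
-/

open scoped BigOperators RealInnerProductSpace

namespace Literature.MathematicalPhysics.QuantumFieldTheory.Balaban1983to89.B3Eq322ZeroTorusTwoDim

open Finset LatticeFieldCalculus B3Sect3ScalarSelfEnergy B3Taylor310Remainder B3Resummation315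
open B3Sect3KernelsZeroTorus B3GkZeroTorusRescaled B3Eq317ZeroTorus B3Eq322OneLegDifferentiated B3Eq322PositiveDegree
open B3TorusRadialSums B3TadpoleZeroTorusTwoDim

noncomputable section

universe u

/-! ## §3 (3.23) in `d = 2`: the vertex function is bounded by `C₁·L^kε` -/

section Bracket

variable {P : Params}

/-- kernel (`d = 2` radial sum): `Σ_{x′∈T}(max(1,|x−x′|_∞))^{−1}e^{−a|x−x′|_∞} ≤ 13 + 24/a` — the diagonal term `1` plus p20 g2's
`radial_sum_le` with `κ = 1`, `p = 0` (`12(1 + 2/a)`), uniformly in the size of the torus. [cite: Balaban1983Higgs3, (3.16) p.437] -/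
theorem inner_radial_le_two (hPd : P.d = 2) {a : ℝ} (ha : 0 < a) (x : Site P 0) :
    ∑ x' : Site P 0, (max (1 : ℝ) (supDist x x' : ℝ))⁻¹ * Real.exp (-(a * (supDist x x' : ℝ))) ≤ 13 + 24 / a := by
  classical
  set F : Site P 0 → ℝ := fun x' => (max (1 : ℝ) (supDist x x' : ℝ))⁻¹ * Real.exp (-(a * (supDist x x' : ℝ))) with hF
  have hsplit : ∑ x' : Site P 0, F x' =
      F x + ∑ x' ∈ univ.filter (fun x' : Site P 0 => x' ≠ x), F x' := by
    rw [← Finset.sum_filter_add_sum_filter_not univ (fun x' : Site P 0 => x' = x)]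
    congr 1
    have hfx : univ.filter (fun x' : Site P 0 => x' = x) = {x} := by
      ext y; simp
    rw [hfx, sum_singleton]
  have hFx : F x = 1 := by
    have h0 : supDist x x = 0 := (B3TorusRadialSums.supDist_eq_zero_iff x x).mpr rfl
    simp only [hF, h0, Nat.cast_zero, mul_zero, neg_zero, Real.exp_zero, mul_one]
    rw [max_eq_left (zero_le_one' ℝ), inv_one]
  have hrad := radial_sum_le x ha (κ := 1) (p := 0) (by rw [hPd])
  have hoff : ∑ x' ∈ univ.filter (fun x' : Site P 0 => x' ≠ x), F x' =
      ∑ x' ∈ univ.filter (fun x' : Site P 0 => x' ≠ x),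
        (((supDist x x' : ℝ)) ^ 1)⁻¹ * Real.exp (-(a * (supDist x x' : ℝ))) := by
    refine sum_congr rfl fun x' hx' => ?_
    have hne : x' ≠ x := (Finset.mem_filter.mp hx').2
    have h1 : (1 : ℝ) ≤ (supDist x x' : ℝ) := by
      have : supDist x x' ≠ 0 := fun h => hne ((B3TorusRadialSums.supDist_eq_zero_iff x x').mp h).symm
      exact_mod_cast Nat.one_le_iff_ne_zero.mpr this
    simp only [hF]
    rw [max_eq_right h1, pow_one]
  have hconst : 2 * (P.d : ℝ) * (3 ^ (P.d - 1) * ((Nat.factorial 0 : ℕ) * (2 / a) ^ 0) * (1 + 2 / a)) = 12 + 24 / a := by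
    rw [hPd]; norm_num; ring
  rw [hsplit, hFx, hoff]
  linarith [hrad.trans_eq hconst]

/-- kernel: `Σ_{i<k}L^i ≤ L^k/(L − 1)` for real `L > 1`. [folklore] -/
private theorem geom_sum_le_pow_div {L : ℝ} (hL : 1 < L) (k : ℕ) : ∑ i ∈ range k, L ^ i ≤ L ^ k / (L - 1) := by
  rw [geom_sum_eq hL.ne' k]
  exact div_le_div_of_nonneg_right (by linarith) (by linarith)

/-- kernel: `k ≤ L^k` for a natural `L > 1`, as reals. [folklore] -/
private theorem cast_le_pow_self {L : ℕ} (hL : 1 < L) (k : ℕ) : (k : ℝ) ≤ (L : ℝ) ^ k := by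
  exact_mod_cast (Nat.lt_pow_self hL).le

/-- **THE (3.23) VERTEX FUNCTION IN `d = 2`, zero-field torus instance** — *"Hence the last graph in (3.22) defines a vertex with some
convergent function"*: for odd `L > 1`, `a > 0`, `m² ≥ 0` there is `C₁ > 0` such that for EVERY volume `P = (2, L, m, K)`, every
`1 ≤ k ≤ K` (`k = j″`), all localizations `|g|, |g′| ≤ 1`, all `μ`, `x`:
`|[bracket (3.23)](G^η_k(0), G^η_k)(x)| = |Σ_{x′}η²(∂^η_μG^η_k)(x,x′)g(x)G^η_k(x,x′)g′(x′)| ≤ C₁·L^kε` — bounded (indeed small with the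
ultraviolet length), by absolute values alone: the row bound `|(∂^η_μG^η_k)(x,x′)| ≤ Cη^{−1}C_s/max(1,|x−x′|_∞)` (p39's scale sum) against
the pieces `|G^η_{(i′)}(x,x′)| ≤ Ce^{−δ|x−x′|_∞/L^{i′}}`, the `d = 2` radial sum `13 + 24L^{i′}/δ` and `Σ_{i′<k}L^{i′} ≤ L^k/(L−1)`,
`kε ≤ L^kε`.  No splitting of `g′` (the p. 439 device for `d = 3`) is needed. [cite: Balaban1983Higgs3, (3.23) p.439] -/
theorem abs_bracket323_le_two (L : ℕ) (hL : Odd L ∧ 1 < L) {a : ℝ} (ha : 0 < a) {msq : ℝ} (hmsq : 0 ≤ msq) :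
    ∃ C₁ : ℝ, 0 < C₁ ∧ ∀ (P : Params), P.d = 2 → P.L = L → ∀ k : ℕ, 1 ≤ k → k ≤ P.K →
      ∀ (g g' : SiteField P 0 ℝ) (μ : Fin P.d), (∀ y, |g y| ≤ 1) → (∀ y, |g' y| ≤ 1) →
        ∀ x : Site P 0,
          |bracket323 P.eps μ (∑ i ∈ range k, gpiece P a msq k i) (∑ i ∈ range k, gpiece P a msq k i) g g' x| ≤
            C₁ * P.spacing k := by
  obtain ⟨δ, C, hδ, hC, HB⟩ := gpiece_bounds_two L hL ha hmsq
  have hL1 : (1 : ℝ) < (L : ℝ) := by exact_mod_cast hL.2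
  have hL0 : (0 : ℝ) < (L : ℝ) := by linarith
  -- p39's scale sum with `p = 1`, the top-scale exponential dropped
  obtain ⟨Cs, hCs, hS⟩ : ∃ Cs : ℝ, 0 < Cs ∧ ∀ k n : ℕ,
      ∑ j ∈ range k, (((L : ℝ)) ^ j)⁻¹ ^ 1 * Real.exp (-(δ * n / (L : ℝ) ^ j)) ≤ Cs * (max (1 : ℝ) (n : ℝ))⁻¹ := by
    have hCs0 := add_nonneg (scaleConst_nonneg hL1 hδ 1) (zeroConst_nonneg hL1 (le_refl 1))
    refine ⟨_ + 1, add_pos_of_nonneg_of_pos hCs0 one_pos, fun k n => (scaleSum_le_max hL1 hδ (le_refl 1) k n).trans ?_⟩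
    have hM : 0 ≤ (max (1 : ℝ) (n : ℝ))⁻¹ := inv_nonneg.mpr (le_max_left _ _ |>.trans' zero_le_one)
    have hE : Real.exp (-(δ / 2 * ((n : ℝ) / (L : ℝ) ^ k))) ≤ 1 :=
      Real.exp_le_one_iff.mpr (neg_nonpos.mpr (by positivity))
    have key : ∀ c M E : ℝ, 0 ≤ c → 0 ≤ M → 0 ≤ E → E ≤ 1 → c * (M ^ 1 * E) ≤ (c + 1) * M := by
      intro c M E hc hM0 hE0 hE1
      rw [pow_one]
      nlinarith [mul_le_mul_of_nonneg_left hE1 hM0, mul_nonneg hc hM0]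
    exact key _ _ _ hCs0 hM (Real.exp_pos _).le hE
  refine ⟨C * C * Cs * (13 + 24 / (δ * ((L : ℝ) - 1))), by
    have : 0 < (L : ℝ) - 1 := by linarith
    positivity, ?_⟩
  intro P hPd hPL k hk1 hkK g g' μ hg hg' x
  obtain ⟨hval, hrow⟩ := HB P hPd hPL k hk1 hkK
  have hε : 0 < P.eps := P.eps_pos
  have hPL' : ((P.L : ℝ)) = (L : ℝ) := by rw [hPL]
  set Gk : Kernel P 0 := ∑ i ∈ range k, gpiece P a msq k i with hGk
  -- the two kernel majorants, in the sup distance `n = |x − x′|_∞`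
  set M : Site P 0 → ℝ := fun x' => (max (1 : ℝ) (supDist x x' : ℝ))⁻¹ with hM
  set E : ℕ → Site P 0 → ℝ := fun i x' => Real.exp (-(δ * (supDist x x' : ℝ) / (L : ℝ) ^ i)) with hE
  have hM0 : ∀ x', 0 ≤ M x' := fun x' => inv_nonneg.mpr (le_max_left _ _ |>.trans' zero_le_one)
  have hE0 : ∀ i x', 0 ≤ E i x' := fun i x' => (Real.exp_pos _).le
  -- (row) `|(∂^η_μG^η_k)(x,x′)| ≤ C·ε⁻¹·C_s·M(x′)`
  have hD : ∀ x' : Site P 0, |d1Kernel P.eps⁻¹ μ Gk x x'| ≤ C * P.eps⁻¹ * (Cs * M x') := by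
    intro x'
    rw [hGk, d1Kernel_finset_sum]
    have hsi : ∀ i : ℕ, (P.spacing i)⁻¹ = P.eps⁻¹ * ((L : ℝ) ^ i)⁻¹ := fun i => by
      rw [Params.spacing, hPL', mul_inv, mul_comm]
    calc |∑ i ∈ range k, d1Kernel P.eps⁻¹ μ (gpiece P a msq k i) x x'|
        ≤ ∑ i ∈ range k, |d1Kernel P.eps⁻¹ μ (gpiece P a msq k i) x x'| := abs_sum_le_sum_abs _ _
      _ ≤ ∑ i ∈ range k, C * P.eps⁻¹ * ((((L : ℝ)) ^ i)⁻¹ ^ 1 * E i x') := by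
          refine sum_le_sum fun i _ => (hrow i μ x x').trans ?_
          have hexp := piece_exp_le P hδ.le i x x'
          rw [hPL'] at hexp
          calc C * (P.spacing i)⁻¹ * Real.exp (-(δ * (P.spacing i)⁻¹ * (P.eps * (Site.tdist x x' : ℝ))))
              ≤ C * (P.spacing i)⁻¹ * E i x' :=
                mul_le_mul_of_nonneg_left hexp (by have := P.spacing_pos i; positivity)
            _ = C * P.eps⁻¹ * ((((L : ℝ)) ^ i)⁻¹ ^ 1 * E i x') := by rw [hsi, pow_one]; ring
      _ = C * P.eps⁻¹ * ∑ i ∈ range k, (((L : ℝ)) ^ i)⁻¹ ^ 1 * E i x' := by rw [Finset.mul_sum]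
      _ ≤ C * P.eps⁻¹ * (Cs * M x') :=
          mul_le_mul_of_nonneg_left (hS k (supDist x x')) (by positivity)
  -- (value) `|G^η_k(x,x′)| ≤ Σ_{i′<k}C·E_{i′}(x′)`
  have hG : ∀ x' : Site P 0, |Gk x x'| ≤ ∑ i' ∈ range k, C * E i' x' := by
    intro x'
    rw [hGk, sum_gpiece_apply]
    refine (abs_sum_le_sum_abs _ _).trans (sum_le_sum fun i' _ => (hval i' x x').trans ?_)
    have hexp := piece_exp_le P hδ.le i' x x'
    rw [hPL'] at hexp
    exact mul_le_mul_of_nonneg_left hexp hC.le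
  -- the inner radial sums, scale by scale
  have hinner : ∀ i' : ℕ, ∑ x' : Site P 0, M x' * E i' x' ≤ 13 + 24 * (L : ℝ) ^ i' / δ := by
    intro i'
    have hai : 0 < δ / (L : ℝ) ^ i' := div_pos hδ (pow_pos hL0 _)
    have h := inner_radial_le_two hPd hai x
    have hre : ∀ x' : Site P 0, M x' * E i' x' =
        (max (1 : ℝ) (supDist x x' : ℝ))⁻¹ * Real.exp (-(δ / (L : ℝ) ^ i' * (supDist x x' : ℝ))) := by
      intro x'; simp only [hM, hE]; congr 2; ring
    simp only [hre]
    refine h.trans (le_of_eq ?_)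
    field_simp
  have hεd : P.eps ^ P.d = P.eps ^ 2 := by rw [hPd]
  unfold bracket323
  calc |∑ x' : Site P 0, P.eps ^ P.d * (d1Kernel P.eps⁻¹ μ Gk x x' * g x * Gk x x' * g' x')|
      ≤ ∑ x' : Site P 0, |P.eps ^ P.d * (d1Kernel P.eps⁻¹ μ Gk x x' * g x * Gk x x' * g' x')| := abs_sum_le_sum_abs _ _
    _ ≤ ∑ x' : Site P 0, P.eps ^ 2 * ((C * P.eps⁻¹ * (Cs * M x')) * ∑ i' ∈ range k, C * E i' x') := by
        refine sum_le_sum fun x' _ => ?_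
        rw [abs_mul, hεd, abs_of_nonneg (by positivity : (0 : ℝ) ≤ P.eps ^ 2)]
        refine mul_le_mul_of_nonneg_left ?_ (by positivity)
        rw [abs_mul, abs_mul, abs_mul]
        have h1 : |d1Kernel P.eps⁻¹ μ Gk x x'| * |g x| * |Gk x x'| * |g' x'| ≤
            |d1Kernel P.eps⁻¹ μ Gk x x'| * 1 * |Gk x x'| * 1 := by
          gcongr
          · exact hg x
          · exact hg' x'
        refine h1.trans ?_
        rw [mul_one, mul_one]
        exact mul_le_mul (hD x') (hG x') (abs_nonneg _)
          (by have := hM0 x'; positivity)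
    _ = C * C * Cs * P.eps * ∑ x' : Site P 0, ∑ i' ∈ range k, M x' * E i' x' := by
        rw [Finset.mul_sum]
        refine sum_congr rfl fun x' _ => ?_
        rw [Finset.mul_sum, Finset.mul_sum, Finset.mul_sum]
        refine sum_congr rfl fun i' _ => ?_
        field_simp
    _ = C * C * Cs * P.eps * ∑ i' ∈ range k, ∑ x' : Site P 0, M x' * E i' x' := by rw [Finset.sum_comm]
    _ ≤ C * C * Cs * P.eps * ∑ i' ∈ range k, (13 + 24 * (L : ℝ) ^ i' / δ) := by
        refine mul_le_mul_of_nonneg_left (sum_le_sum fun i' _ => hinner i') (by positivity)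
    _ = C * C * Cs * (13 * (k * P.eps) + 24 / δ * ((∑ i' ∈ range k, (L : ℝ) ^ i') * P.eps)) := by
        rw [sum_add_distrib, sum_const, card_range, nsmul_eq_mul, ← Finset.sum_div, ← Finset.mul_sum]
        ring
    _ ≤ C * C * Cs * (13 * ((L : ℝ) ^ k * P.eps) + 24 / δ * ((L : ℝ) ^ k / ((L : ℝ) - 1) * P.eps)) := by
        have h1 : (k : ℝ) * P.eps ≤ (L : ℝ) ^ k * P.eps :=
          mul_le_mul_of_nonneg_right (cast_le_pow_self hL.2 k) hε.le
        have h2 : (∑ i' ∈ range k, (L : ℝ) ^ i') * P.eps ≤ (L : ℝ) ^ k / ((L : ℝ) - 1) * P.eps :=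
          mul_le_mul_of_nonneg_right (geom_sum_le_pow_div hL1 k) hε.le
        have h3 : 0 ≤ 24 / δ := by positivity
        nlinarith [mul_le_mul_of_nonneg_left h2 h3, mul_pos (mul_pos hC hC) hCs]
    _ = C * C * Cs * (13 + 24 / (δ * ((L : ℝ) - 1))) * P.spacing k := by
        rw [Params.spacing, hPL']
        have hL1' : (L : ℝ) - 1 ≠ 0 := by linarith
        field_simp

/-- **(3.23) IN `d = 2`, zero-field torus instance: the vertex has the coefficient `≤ C₁·L^kε`** — for odd `L > 1`, `a > 0`, `m² ≥ 0`
there is `C₁ > 0` with, for every volume `P = (2, L, m, K)`, every `1 ≤ k ≤ K`, every `q`, `|g|,|g′| ≤ 1`, all `φ, φ′`: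
`|(3.23)[G^η_k(0), G^η_k]| ≤ C₁(L^kε)·Σ_μΣ_xη²‖φ(x)‖‖q²(∂^η_μφ′)(x)‖`. [cite: Balaban1983Higgs3, (3.23) p.439] -/
theorem abs_expr323_le_two (L : ℕ) (hL : Odd L ∧ 1 < L) {a : ℝ} (ha : 0 < a) {msq : ℝ} (hmsq : 0 ≤ msq) :
    ∃ C₁ : ℝ, 0 < C₁ ∧ ∀ (P : Params), P.d = 2 → P.L = L → ∀ k : ℕ, 1 ≤ k → k ≤ P.K →
      ∀ {W : Type u} [NormedAddCommGroup W] [InnerProductSpace ℝ W] (q : W →ₗ[ℝ] W)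
        (g g' : SiteField P 0 ℝ) (φ φ' : SiteField P 0 W), (∀ y, |g y| ≤ 1) → (∀ y, |g' y| ≤ 1) →
        |expr323 P.eps q (∑ i ∈ range k, gpiece P a msq k i) (∑ i ∈ range k, gpiece P a msq k i) g g' φ φ'| ≤
          C₁ * P.spacing k *
            ∑ μ : Fin P.d, ∑ x : Site P 0, P.eps ^ P.d * (‖φ x‖ * ‖q (q (pdiff P.eps⁻¹ μ φ' x))‖) := by
  obtain ⟨C₁, hC₁, H⟩ := abs_bracket323_le_two L hL ha hmsq
  refine ⟨C₁, hC₁, fun P hPd hPL k hk1 hkK W _ _ q g g' φ φ' hg hg' => ?_⟩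
  have hε : 0 < P.eps := P.eps_pos
  have hCst : 0 ≤ C₁ * P.spacing k := by have := P.spacing_pos k; positivity
  unfold expr323
  rw [Finset.mul_sum]
  refine (Finset.abs_sum_le_sum_abs _ _).trans (Finset.sum_le_sum fun μ _ => ?_)
  rw [Finset.mul_sum]
  refine (Finset.abs_sum_le_sum_abs _ _).trans (Finset.sum_le_sum fun x _ => ?_)
  rw [abs_mul, abs_of_nonneg (by positivity : (0 : ℝ) ≤ P.eps ^ P.d), abs_mul]
  have hb := H P hPd hPL k hk1 hkK g g' μ hg hg' x
  have hi : |⟪φ x, q (q (pdiff P.eps⁻¹ μ φ' x))⟫| ≤ ‖φ x‖ * ‖q (q (pdiff P.eps⁻¹ μ φ' x))‖ := abs_real_inner_le_norm _ _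
  have h0 : 0 ≤ ‖φ x‖ * ‖q (q (pdiff P.eps⁻¹ μ φ' x))‖ := by positivity
  calc P.eps ^ P.d * (|bracket323 P.eps μ (∑ i ∈ range k, gpiece P a msq k i) (∑ i ∈ range k, gpiece P a msq k i) g g' x| *
          |⟪φ x, q (q (pdiff P.eps⁻¹ μ φ' x))⟫|)
      ≤ P.eps ^ P.d * ((C₁ * P.spacing k) * (‖φ x‖ * ‖q (q (pdiff P.eps⁻¹ μ φ' x))‖)) :=
        mul_le_mul_of_nonneg_left (mul_le_mul hb hi (abs_nonneg _) hCst) (by positivity)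
    _ = C₁ * P.spacing k * (P.eps ^ P.d * (‖φ x‖ * ‖q (q (pdiff P.eps⁻¹ μ φ' x))‖)) := by ring

/-- **(3.23) p. 439 AT THE ZERO-FIELD TORUS MODEL INSTANCE, `d = 2`** (p20 g6's `eq323_zero_torus` at `d = 2`) — *"we sum over
proper orderings and j-indices and we get (3.23) … Hence the last graph in (3.22) defines a vertex with some convergent function"*:
for odd `L > 1`, `a > 0`, `m² ≥ 0` there is `C₁ > 0` such that for EVERY volume `P = (2, L, m, K)`, every `1 ≤ k ≤ K` (`k = j″`),
every `q`, `|g|,|g′| ≤ 1`, all `φ, φ′`: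
(a) `Σ_{j,j′<k}(3.23)-term[G^η_{(j)}(0), G^η_{(j′)}] = (3.23)[G^η_k(0), G^η_k]` for the tower pieces (multilinearity, `expr323_sum_sum`);
(b) `|(3.23)[G^η_k(0), G^η_k]| ≤ C₁(L^kε)·Σ_μΣ_xη²‖φ(x)‖‖q²(∂^η_μφ′)(x)‖ ≤ C₁·Σ_μΣ_xη²‖φ(x)‖‖q²(∂^η_μφ′)(x)‖` (`L^kε ≤ 1`) — the
coefficient bounded uniformly in the volume and the scale (and vanishing with the ultraviolet length).  In `d = 2` no Lipschitz
hypothesis on `g′` enters. [cite: Balaban1983Higgs3, (3.23) p.439] -/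
theorem eq323_zero_torus_two (L : ℕ) (hL : Odd L ∧ 1 < L) {a : ℝ} (ha : 0 < a) {msq : ℝ} (hmsq : 0 ≤ msq) :
    ∃ C₁ : ℝ, 0 < C₁ ∧ ∀ (P : Params), P.d = 2 → P.L = L → ∀ k : ℕ, 1 ≤ k → k ≤ P.K →
      ∀ {W : Type u} [NormedAddCommGroup W] [InnerProductSpace ℝ W] (q : W →ₗ[ℝ] W)
        (g g' : SiteField P 0 ℝ) (φ φ' : SiteField P 0 W), (∀ y, |g y| ≤ 1) → (∀ y, |g' y| ≤ 1) →
          (∑ i ∈ range k, ∑ i' ∈ range k, expr323 P.eps q (gpiece P a msq k i) (gpiece P a msq k i') g g' φ φ' =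
              expr323 P.eps q (∑ i ∈ range k, gpiece P a msq k i) (∑ i ∈ range k, gpiece P a msq k i) g g' φ φ') ∧
          |expr323 P.eps q (∑ i ∈ range k, gpiece P a msq k i) (∑ i ∈ range k, gpiece P a msq k i) g g' φ φ'| ≤
            C₁ * P.spacing k *
              ∑ μ : Fin P.d, ∑ x : Site P 0, P.eps ^ P.d * (‖φ x‖ * ‖q (q (pdiff P.eps⁻¹ μ φ' x))‖) ∧
          |expr323 P.eps q (∑ i ∈ range k, gpiece P a msq k i) (∑ i ∈ range k, gpiece P a msq k i) g g' φ φ'| ≤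
            C₁ * ∑ μ : Fin P.d, ∑ x : Site P 0, P.eps ^ P.d * (‖φ x‖ * ‖q (q (pdiff P.eps⁻¹ μ φ' x))‖) := by
  obtain ⟨C₁, hC₁, H⟩ := abs_expr323_le_two.{u} L hL ha hmsq
  refine ⟨C₁, hC₁, fun P hPd hPL k hk1 hkK W _ _ q g g' φ φ' hg hg' => ⟨?_, ?_, ?_⟩⟩
  · exact expr323_sum_sum (range k) (range k) P.eps q (fun i => gpiece P a msq k i) (fun i => gpiece P a msq k i) g g' φ φ'
  · exact H P hPd hPL k hk1 hkK q g g' φ φ' hg hg'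
  · refine (H P hPd hPL k hk1 hkK q g g' φ φ' hg hg').trans (mul_le_mul_of_nonneg_right ?_ ?_)
    · have hs1 : P.spacing k ≤ 1 := spacing_le_one P hkK
      have := P.spacing_pos k
      nlinarith
    · exact Finset.sum_nonneg fun μ _ => Finset.sum_nonneg fun x _ => by
        have := P.eps_pos; positivity

end Bracket

/-! ## §4 (3.22) in `d = 2`: the split and the estimates, piece by piece -/

section Eq322

/-- **(3.22)–(3.23) p. 439 AT THE ZERO-FIELD TORUS MODEL INSTANCE, `d = 2`** (p18 g8's `eq322_zero_torus` at `d = 2`) — the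
analysis of the second graph of (3.21) end to end for the lines `G_{(j)}(0) = G_{(j′)} = G^η_{(j)}` of Bałaban's scalar torus tower
(`A = B̃ = 0`, `Ω = T_η`, `η = ε`): for odd `L > 1`, `a > 0`, `m² ≥ 0` there are `δ, C, C₁ > 0` (functions of `L, a, m²`) such that for
EVERY volume `P = (2,L,m,K)`, every `1 ≤ k ≤ K` (`k = j″`), every charge matrix (`‖qw‖ ≤ Q‖w‖`), localizations `|g|,|g′| ≤ 1`, every
field `φ` and Hölder-α leg `φ′` (`0 ≤ α ≤ 1`):
(a) `Σ_{j,j′<k}expr321b[G^η_{(j)},G^η_{(j′)}] = Σ_{j,j′<k}rem322[j,j′] + (3.23)[G^η_k(0),G^η_k]` ((3.22), then the summation over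
orderings and indices); (b) the vertex (3.23) has the coefficient `≤ C₁·L^kε`: `|(3.23)| ≤ C₁(L^kε)·Σ_μΣ_xη²‖φ(x)‖‖q²(∂^η_μφ′)(x)‖`;
(c) every piece `(j,j′)` of the first graph of (3.22) obeys the estimate of `abs_rem322_le` with the kernel hypotheses DISCHARGED
(`gpiece_bounds`, `d = 2`): `|rem322[j,j′]| ≤ d·C²Q²H(1+2/δ)(L^{j₁}η)^α·Σ_{x,x′}η^{2d}‖φ(x)‖(L^jη)^{1−d}e^{−½δ|x−x′|/L^jη}(L^{j′}η)^{2−d}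
e^{−½δ|x−x′|/L^{j′}η}` (`d = 2`: `(L^jη)^{−1}`, `(L^{j′}η)^{0}`) — *"The first graph on the right side has positive degree"*, gain
`(L^{j₁}η)^α`.  In `d = 2` the p. 439 Lipschitz splitting of `g′` is not needed for (b). [cite: Balaban1983Higgs3, (3.22)–(3.23) p.439] -/
theorem eq322_zero_torus_two (L : ℕ) (hL : Odd L ∧ 1 < L) {a : ℝ} (ha : 0 < a) {msq : ℝ} (hmsq : 0 ≤ msq) :
    ∃ δ C C₁ : ℝ, 0 < δ ∧ 0 < C ∧ 0 < C₁ ∧ ∀ (P : Params), P.d = 2 → P.L = L → ∀ k : ℕ, 1 ≤ k → k ≤ P.K →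
      ∀ {W : Type u} [NormedAddCommGroup W] [InnerProductSpace ℝ W] {α H Q : ℝ}, 0 ≤ α → α ≤ 1 → 0 ≤ H → 0 ≤ Q →
        ∀ (q : W →ₗ[ℝ] W), (∀ w : W, ‖q w‖ ≤ Q * ‖w‖) →
        ∀ (g g' : SiteField P 0 ℝ), (∀ x, |g x| ≤ 1) → (∀ x, |g' x| ≤ 1) →
        ∀ (φ φ' : SiteField P 0 W), HolderDeriv (P.eps)⁻¹ α H φ' →
          (∑ i ∈ range k, ∑ i' ∈ range k, expr321b P.eps q (gpiece P a msq k i) (gpiece P a msq k i') g g' φ φ' =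
              (∑ i ∈ range k, ∑ i' ∈ range k, rem322 P.eps q (gpiece P a msq k i) (gpiece P a msq k i') g g' φ φ') +
                expr323 P.eps q (∑ i ∈ range k, gpiece P a msq k i) (∑ i ∈ range k, gpiece P a msq k i) g g' φ φ') ∧
          |expr323 P.eps q (∑ i ∈ range k, gpiece P a msq k i) (∑ i ∈ range k, gpiece P a msq k i) g g' φ φ'| ≤
            C₁ * P.spacing k *
              ∑ μ : Fin P.d, ∑ x : Site P 0, P.eps ^ P.d * (‖φ x‖ * ‖q (q (pdiff P.eps⁻¹ μ φ' x))‖) ∧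
          ∀ i i' : ℕ,
            |rem322 P.eps q (gpiece P a msq k i) (gpiece P a msq k i') g g' φ φ'| ≤
              P.d * C * C * Q ^ 2 * H * (1 + 2 / δ) * (min (P.spacing i) (P.spacing i')) ^ α *
                ∑ x : Site P 0, ∑ x' : Site P 0, P.eps ^ (2 * P.d) *
                  (‖φ x‖ * (P.spacing i ^ ((1 : ℝ) - (P.d : ℝ)) *
                      Real.exp (-(δ / 2 * (P.spacing i)⁻¹ * (P.eps * Site.tdist x x'))))
                    * (P.spacing i' ^ ((2 : ℝ) - (P.d : ℝ)) *
                      Real.exp (-(δ / 2 * (P.spacing i')⁻¹ * (P.eps * Site.tdist x x'))))) := by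
  obtain ⟨δ, C, hδ, hC, Hk⟩ := gpiece_bounds 2 L (by norm_num) hL ha hmsq
  obtain ⟨C₁, hC₁, H23⟩ := abs_expr323_le_two.{u} L hL ha hmsq
  refine ⟨δ, C, C₁, hδ, hC, hC₁, ?_⟩
  intro P hPd hPL k hk1 hkK W _ _ α H Q hα0 hα1 hH hQ q hq g g' hg hg' φ φ' hφ'
  obtain ⟨hv, hrow, -, -⟩ := Hk P hPd hPL k hk1 hkK
  refine ⟨sum_expr321b_eq P.eps q k _ _ g g' φ φ', H23 P hPd hPL k hk1 hkK q g g' φ φ' hg hg', fun i i' => ?_⟩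
  exact abs_rem322_le P.eps P.eps_pos hα0 hα1 hH hQ hδ (P.spacing_pos i) (P.spacing_pos i') q hq _ _ g g' hg hg'
    (fun μ x x' => hrow i μ x x') (hv i') φ φ' hφ'

end Eq322

end

end Literature.MathematicalPhysics.QuantumFieldTheory.Balaban1983to89.B3Eq322ZeroTorusTwoDim
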